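import Literature.AlgebraicGeometry.Motives.CubeFunctionQuadratic
import Literature.AlgebraicGeometry.Motives.CartierDivisorClassMap
import Literature.AlgebraicGeometry.Motives.AbelianVarietyKerRankOfCube
import Literature.AlgebraicGeometry.Motives.AbelianVarietyDimZeroProofs
import HarnessLib

/-!
# A polynomial bound for the degree on `End(X)` from the theorem of the cube (Mumford §19, Thm. 2/3)

Mumford, *Abelian Varieties*, §19, Theorem 2 states that `deg : End(X) → ℤ` extends to a homogeneous
polynomial function of degree `2g` on `End⁰(X)`; the printed proof computes `deg φ = (φ^*D)^g/(D^g)`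
with intersection numbers and uses the quadraticity of `φ ↦ φ^*D` (§6, Cor. 2 of the theorem of the
cube). The proof of Theorem 3 (`Hom(X, Y)` finitely generated — the named fact
`AbelianVariety.module_finite_hom` of `NumberTheory/DiophantineGeometry/AVIsogenyTate`) consumes
Theorem 2 only through an **upper bound** of degree `2g` on integer combinations
(`exists_fg_saturation_end_of_degBound`, `NumberTheory/DiophantineGeometry/AVIsogenyTateHomDegBoundProofs`).
This file **proves that bound from the theorem of the cube**, without intersection theory:

* `AbelianVariety.classMap_classPullback_cube` — Mumford §6 Cor. 2 on divisor classes: for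
  homomorphisms `f, g, h : X → Y` and a divisor `D` on `Y`,
  `[(f+g+h)^*D] + [f^*D] + [g^*D] + [h^*D] = [(f+g)^*D] + [(f+h)^*D] + [(g+h)^*D]` in any additive model
  of `DivCl(X)` (`CartierDivisor.exists_classMap`), from the cubical structure
  `cubicalStructure_linEquiv Y` (Görtz–Wedhorn II, Prop. 27.167, the named fact of
  `Motives/AbelianVarietyCube`, itself reduced to the theorem of the cube `theoremOfCube_linEquiv` in
  `Motives/AbelianVarietyTheoremOfCube`) with `T = X` and the `T`-valued points `f, g, h`;
* `AbelianVariety.kerRank_sum_le_of_cubicalStructure` — **for `X` of dimension `g > 0` all of whose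
  non-zero endomorphisms are isogenies (e.g. `X` simple), with an ample divisor and the cubical
  structure, and every finite family `e` of endomorphisms, there is `C` with
  `deg (∑ nᵢ eᵢ) ≤ C (∑ |nᵢ|)^{2g}` for all `n ∈ ℤ^r`** (`deg = Hom.kerRank`, the order of the kernel,
  for isogenies; `0` otherwise). Proof: `φ ↦ [φ^*D]` is a cube function `End(X) → DivCl(X)`, so
  (`CubeFunction.exists_expansion`) `[f^*D] = ∑_k c_k(n) [g_k^*D]`, `|c_k(n)| ≤ C₀(1 + ∑|nᵢ|)²`, for
  `f = ∑ nᵢ eᵢ` and a fixed finite family of non-zero `g_k` (isogenies, so `g_k^*D` is an honest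
  effective ample divisor when `D` is); hence, with `H ∼ D + ∑_k g_k^*D` ample and
  `M = C₀(1 + ∑|nᵢ|)² + 1`, `Γ(𝒪(m f^*D)) ↪ Γ(𝒪(m M H))` for all `m`
  (`CartierDivisor.exists_injective_of_classMap_eq_add`), and the leading coefficients of
  Görtz–Wedhorn II, Prop. 23.83/23.84 (proved in the tree: `asymptoticRiemannRoch_of_isAmple_holds`,
  `asympDegree_pullback_eq_holds`) compare as `deg(f) δ_D ≤ δ_H M^g`
  (`CartierDivisor.le_of_injective_sections`);
* `AbelianVariety.kerRank_sum_le_of_theoremOfCube` — the same with the cubical structure and the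
  ample divisor supplied by the theorem of the cube (`cubicalStructure_linEquiv_of_theoremOfCube`,
  `exists_isAmple_symmetric_of_cube`), so that **the degree input of Mumford §19 Thm. 3 rests on
  `theoremOfCube_linEquiv` alone**.

## References

* [MumfordAV1970] D. Mumford, *Abelian Varieties*, TIFR Studies in Mathematics 5, OUP (1970):
  §6, Cor. 2 of the theorem of the cube (p. 58); §19, Thm. 2 (p. 174) and the proof of Thm. 3
  (pp. 176–178) (2nd-ed. pagination; not held, architecture as in Milne 1986, §12).
* [Milne1986AbelianVarieties] J. S. Milne, *Abelian Varieties*, in Cornell–Silverman (eds.),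
  *Arithmetic Geometry*, Springer 1986, §12, Prop. 12.4 and Lemma 12.7 (held:
  `book:cornellnd-arithmetic-geometry`, PDF pp. 190–191).
* [GortzWedhorn2023] U. Görtz, T. Wedhorn, *Algebraic Geometry II* (2023): Prop. 27.167 (p. 877),
  Prop. 23.83/23.84 (p. 447), Thm. 24.73 (p. 550).

## Design

No definitions, no named facts. The divisor class group enters through the existential
`CartierDivisor.exists_classMap`; the two lemmas on class pullbacks are stated for an arbitrary
additive class map `cl` (hypotheses `hadd`, `heq`).
-/

universe u

open CategoryTheory AlgebraicGeometry Filter Topology Asymptotics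
open Literature.AlgebraicGeometry.Motives.RatFn

noncomputable section

namespace Literature.AlgebraicGeometry.Motives

namespace AbelianVariety


open scoped MonObj

variable {K : Type u} [Field K] {X Y : AbelianVariety K}

/-- The scheme morphism underlying `0 : X → Y` is the neutral `X`-valued point of `Y`. [folklore] -/
theorem toSchemeHom_zero_eq_one_left : Hom.toSchemeHom (0 : X ⟶ Y) = (1 : X.X ⟶ Y.X).left := rfl

section ClassMap

variable {Q : Type*} [AddCommGroup Q] {cl : CartierDivisor X.X.left → Q}
  (hadd : ∀ D E : CartierDivisor X.X.left, cl (D + E) = cl D + cl E)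
  (heq : ∀ D E : CartierDivisor X.X.left, D.LinEquiv E ↔ cl D = cl E)
include hadd heq

/-- `[0^* D] = 0`: the class pullback along the zero homomorphism is trivial. [folklore] -/
theorem classMap_classPullback_zero (D : CartierDivisor Y.X.left) :
    cl (D.classPullback (Hom.toSchemeHom (0 : X ⟶ Y))) = 0 := by
  rw [toSchemeHom_zero_eq_one_left, (heq _ _).1 (CartierDivisor.classPullback_linEquiv_zero_of_const _
    (fun y y' => by rw [one_left_apply, one_left_apply]) D)]
  exact CartierDivisor.classMap_zero hadd heq

/-- **Mumford §6, Cor. 2 of the theorem of the cube, on divisor classes**: for homomorphisms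
`f, g, h : X → Y` of abelian varieties and a divisor `D` on `Y`,
`[(f+g+h)^*D] + [f^*D] + [g^*D] + [h^*D] = [(f+g)^*D] + [(f+h)^*D] + [(g+h)^*D]`, from the cubical
structure (Görtz–Wedhorn II, Prop. 27.167) with `T = X` and the `T`-valued points `f`, `g`, `h`.
[cite: MumfordAV1970, §6 Cor. 2 (p. 58)] -/
theorem classMap_classPullback_cube (hcs : cubicalStructure_linEquiv Y) (D : CartierDivisor Y.X.left)
    (f g h : X ⟶ Y) :
    cl (D.classPullback (Hom.toSchemeHom (f + g + h))) + cl (D.classPullback (Hom.toSchemeHom f)) +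
        cl (D.classPullback (Hom.toSchemeHom g)) + cl (D.classPullback (Hom.toSchemeHom h)) =
      cl (D.classPullback (Hom.toSchemeHom (f + g))) + cl (D.classPullback (Hom.toSchemeHom (f + h))) +
        cl (D.classPullback (Hom.toSchemeHom (g + h))) := by
  have hc := (heq _ _).1 (hcs X.X f.hom.hom.hom g.hom.hom.hom h.hom.hom.hom D)
  simp only [hadd] at hc
  have h1 : cl (D.classPullback (1 : X.X ⟶ Y.X).left) = 0 := classMap_classPullback_zero hadd heq D
  rw [h1, add_zero] at hc
  exact hc

end ClassMap

open Classical in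
/-- **A polynomial bound for the degree on integer combinations of endomorphisms** (the part of
Mumford, *Abelian Varieties*, §19, Thm. 2 that the proof of Thm. 3 consumes). Let `X` be an abelian
variety of dimension `g > 0` all of whose non-zero endomorphisms are isogenies (e.g. `X` simple),
carrying an ample divisor, and assume the cubical structure on the line bundles of `X`
(Görtz–Wedhorn II, Prop. 27.167 — the theorem of the cube). Then for every finite family `e` of
endomorphisms there is `C` with `deg (∑ nᵢ eᵢ) ≤ C (∑ |nᵢ|)^{2g}` for all `n ∈ ℤ^r`. Proof: by
Mumford §6 Cor. 2, `φ ↦ [φ^* D]` is a quadratic map `End(X) → DivCl(X)`, so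
`[f^* D] = ∑_k c_k(n) [g_k^* D]` with `|c_k(n)| ≤ C₀ (1 + ∑|nᵢ|)²` for `f = ∑ nᵢ eᵢ` and a fixed
finite family `g_k` of isogenies; with `D` effective ample and `H = D + ∑_k g_k^* D` this embeds
`Γ(𝒪(m f^*D))` into `Γ(𝒪(m M H))`, `M = C₀(1 + ∑|nᵢ|)² + 1`, whence
`deg(f) deg(D) = deg(f^* D) ≤ M^g deg(H)` by asymptotic Riemann–Roch (Görtz–Wedhorn II,
Prop. 23.83/23.84). [cite: MumfordAV1970, §19 Thm. 2 (p. 174) and §6 Cor. 2 (p. 58)] -/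
theorem kerRank_sum_le_of_cubicalStructure (X : AbelianVariety K)
    (hcs : cubicalStructure_linEquiv X) (hamp : ∃ D : CartierDivisor X.X.left, D.IsAmple)
    (hiso : ∀ φ : X ⟶ X, φ ≠ 0 → IsIsogeny φ) (hX : 0 < X.dim) (r : ℕ) (e : Fin r → (X ⟶ X)) :
    ∃ C : ℤ, ∀ n : Fin r → ℤ,
      (if IsIsogeny (∑ i, n i • e i) then (Hom.kerRank (∑ i, n i • e i) : ℤ) else 0) ≤
        C * (∑ i, |n i|) ^ (2 * X.dim) := by
  classical
  -- a class map
  obtain ⟨Q, _, cl, hadd, heq⟩ := CartierDivisor.exists_classMap X.X.left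
  -- an effective ample divisor
  obtain ⟨D₀, hD₀⟩ := hamp
  obtain ⟨D, hD, hDeff⟩ := hD₀.exists_isAmple_isEffective
  -- the quadratic map `L φ = [φ^* D]`
  set L : (X ⟶ X) → Q := fun φ => cl (D.classPullback (Hom.toSchemeHom φ)) with hLdef
  have h0L : L 0 = 0 := classMap_classPullback_zero hadd heq D
  have hcubeL : ∀ x y z : X ⟶ X,
      L (x + y + z) + L x + L y + L z = L (x + y) + L (x + z) + L (y + z) :=
    fun x y z => classMap_classPullback_cube hadd heq hcs D x y z
  obtain ⟨J, _, g, c, C₀, hc, hL⟩ := CubeFunction.exists_expansion hcubeL h0L r e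
  -- the non-zero members of the family and their pullback divisors
  have hgi : ∀ k : {k : J // g k ≠ 0}, IsIsogeny (g k) := fun k => hiso _ k.2
  let G : {k : J // g k ≠ 0} → CartierDivisor X.X.left := fun k =>
    haveI := (hgi k).1
    D.pullback (Hom.toSchemeHom (g (k : J)))
  have hGeff : ∀ k, (G k).IsEffective := fun k => by
    haveI := (hgi k).1
    exact hDeff.pullback _
  have hGamp : ∀ k, (G k).IsAmple := fun k => by
    haveI := (hgi k).1
    haveI := (hgi k).2
    exact hD.pullback _
  have hGcl : ∀ k, cl (G k) = L (g k) := fun k => by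
    haveI := (hgi k).1
    exact ((heq _ _).1 (CartierDivisor.classPullback_linEquiv_pullback _ D)).symm
  -- an ample `H` with `[H] = [D] + ∑ [G k]`
  obtain ⟨H, hH, hclH⟩ :=
    CartierDivisor.exists_isAmple_classMap_eq_add_sum hadd Finset.univ hD G fun k _ => hGamp k
  -- asymptotic Riemann–Roch for `D` and `H`
  haveI : IsProper (X.X.left ↘ Spec (.of K)) := X.isProper
  obtain ⟨δ, hδ, hD1⟩ := CartierDivisor.asymptoticRiemannRoch_of_isAmple_holds K X.X.left D hD
  obtain ⟨δH, hδH, hH1⟩ := CartierDivisor.asymptoticRiemannRoch_of_isAmple_holds K X.X.left H hH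
  set d := X.dim with hd
  have hdim : schemeDim X.X.left = d := rfl
  -- the constant
  refine ⟨(δH : ℤ) * ((4 * C₀ + 1 : ℕ) : ℤ) ^ d, fun n => ?_⟩
  set f := ∑ i, n i • e i with hf
  set S : ℕ := ∑ i, (n i).natAbs with hS
  have hSint : (∑ i, |n i| : ℤ) = S := by rw [hS]; push_cast; rfl
  by_cases hfi : IsIsogeny f
  swap
  · rw [if_neg hfi]; positivity
  rw [if_pos hfi, hSint]
  -- `f ≠ 0`, so `S ≥ 1`
  have hf0 : f ≠ 0 := fun h => not_isIsogeny_zero_of_dim_pos hX (h ▸ hfi)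
  have hS1 : 1 ≤ S := by
    by_contra hlt
    have hS0 : S = 0 := by omega
    apply hf0
    rw [hf]
    refine Finset.sum_eq_zero fun i _ => ?_
    have h1 : (n i).natAbs = 0 := Finset.sum_eq_zero_iff.1 hS0 i (Finset.mem_univ _)
    rw [Int.natAbs_eq_zero.1 h1, zero_smul]
  -- the size of the coefficients
  set M : ℕ := C₀ * (1 + S) ^ 2 + 1 with hM
  have hM0 : 0 < M := Nat.succ_pos _
  have hcM : ∀ k, |c n k| < M := fun k => by
    have h1 := hc n k
    rw [hSint] at h1
    have h2 : (C₀ : ℤ) * (1 + (S : ℤ)) ^ 2 < M := by rw [hM]; push_cast; linarith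
    exact lt_of_le_of_lt h1 h2
  let cp : {k : J // g k ≠ 0} → ℕ := fun k => (c n k).toNat
  let cm : {k : J // g k ≠ 0} → ℕ := fun k => (-c n k).toNat
  have hcpM : ∀ k, cp k ≤ M := fun k => by
    have h1 := hcM k
    have h2 : ((c n k).toNat : ℤ) ≤ M := by
      rcases le_or_gt 0 (c n k) with h | h
      · rw [Int.toNat_of_nonneg h]; exact (le_abs_self _).trans h1.le
      · rw [Int.toNat_eq_zero.2 h.le]; positivity
    exact_mod_cast h2
  -- identity in `Q`: `L f + ∑ cm • [G] = ∑ cp • [G]`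
  have hLf : L f = ∑ k : {k : J // g k ≠ 0}, c n k • cl (G k) := by
    rw [hf, hL n, ← Fintype.sum_subtype_add_sum_subtype (fun k => g k ≠ 0)]
    have hz : ∑ k : {k : J // ¬ g k ≠ 0}, c n k • L (g k) = 0 :=
      Finset.sum_eq_zero fun k _ => by
        have hk : g k = 0 := not_not.1 k.2
        rw [hk, h0L, smul_zero]
    rw [hz, add_zero]
    exact Finset.sum_congr rfl fun k _ => by rw [hGcl]
  have hident : L f + ∑ k, cm k • cl (G k) = ∑ k, cp k • cl (G k) := by
    rw [hLf, ← Finset.sum_add_distrib]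
    refine Finset.sum_congr rfl fun k _ => ?_
    rw [← natCast_zsmul _ (cm k), ← natCast_zsmul _ (cp k), ← add_smul]
    congr 1
    have := Int.toNat_sub_toNat_neg (c n k)
    simp only [cp, cm]
    linarith
  -- effective representatives
  obtain ⟨Ep, -, hclEp⟩ :=
    CartierDivisor.exists_isEffective_classMap_eq_sum hadd heq Finset.univ cp G fun k _ => hGeff k
  obtain ⟨Em, hEm, hclEm⟩ :=
    CartierDivisor.exists_isEffective_classMap_eq_sum hadd heq Finset.univ cm G fun k _ => hGeff k
  obtain ⟨Rm, hRm, hclRm⟩ :=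
    CartierDivisor.exists_isEffective_classMap_eq_sum hadd heq Finset.univ (fun k => M - cp k) G
      fun k _ => hGeff k
  -- the pullback `f^* D`
  haveI : Surjective (Hom.toSchemeHom f) := hfi.1
  haveI : IsFinite (Hom.toSchemeHom f) := hfi.2
  haveI : Flat (Hom.toSchemeHom f) := IsIsogeny.flat_toSchemeHom_holds hfi
  set Df := D.pullback (Hom.toSchemeHom f) with hDf
  have hclDf : cl Df = L f :=
    (heq _ _).1 (CartierDivisor.classPullback_linEquiv_pullback _ D).symm
  -- the three class identities
  have hA1 : cl (Df + Em) = cl Df + cl Em := hadd _ _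
  have hA2 : cl (Df + Em) = cl Ep := by rw [hadd, hclDf, hclEm, hclEp]; exact hident
  have hA3 : cl (M • H) = cl Ep + cl (M • D + Rm) := by
    rw [CartierDivisor.classMap_smul hadd heq, hclH, hadd,
      CartierDivisor.classMap_smul hadd heq, hclEp, hclRm, smul_add, Finset.smul_sum,
      add_left_comm, ← Finset.sum_add_distrib]
    congr 1
    refine Finset.sum_congr rfl fun k _ => ?_
    rw [← add_smul, Nat.add_sub_cancel' (hcpM k)]
  -- embeddings of sections for every `m`
  have hinj : ∀ m : ℕ, ∃ φ : (m • Df).sections K →ₗ[K] (m • (M • H)).sections K,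
      Function.Injective φ := fun m => by
    obtain ⟨φ₁, hφ₁⟩ :=
      CartierDivisor.exists_injective_of_classMap_eq_add hadd heq K hA1 hEm m
    obtain ⟨e₂⟩ := CartierDivisor.nonempty_sectionsEquiv_of_linEquiv K
      (((heq _ _).2 hA2).smul m)
    obtain ⟨φ₃, hφ₃⟩ := CartierDivisor.exists_injective_of_classMap_eq_add hadd heq K hA3
      ((hDeff.smul M).add hRm) m
    exact ⟨φ₃.comp (e₂.toLinearMap.comp φ₁), hφ₃.comp (e₂.injective.comp hφ₁)⟩
  -- asymptotics of `f^* D`: `h⁰(m f^*D) = deg(f) δ m^d/d! + O(m^{d-1})`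
  set rk := Hom.kerRank f with hrk
  have hr : ∀ y, (Hom.toSchemeHom f).finrank y = rk := hfi.finrank_eq_kerRank
  have hD2 := CartierDivisor.hasAsympDegree_pullback_of_facts
    CartierDivisor.asymptoticRiemannRoch_of_isAmple_holds CartierDivisor.asympDegree_pullback_eq_holds
    (Hom.toSchemeHom f) rk hr hD hD1
  rw [hdim] at hD1 hD2 hH1
  have key : rk * δ ≤ δH * M ^ d :=
    CartierDivisor.le_of_injective_sections K hD2 hH1 hδH hM0 (Eventually.of_forall hinj)
  -- arithmetic: `deg f ≤ deg f · δ ≤ δH M^d ≤ δH (4 C₀ + 1)^d S^{2d}`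
  have hS2 : 1 ≤ S ^ 2 := Nat.one_le_pow _ _ hS1
  have h4 : (1 + S) ^ 2 ≤ 4 * S ^ 2 := by nlinarith
  have hMS : M ≤ (4 * C₀ + 1) * S ^ 2 :=
    calc M = C₀ * (1 + S) ^ 2 + 1 := rfl
      _ ≤ C₀ * (4 * S ^ 2) + S ^ 2 := add_le_add (Nat.mul_le_mul_left _ h4) hS2
      _ = (4 * C₀ + 1) * S ^ 2 := by ring
  have h1 : rk ≤ δH * ((4 * C₀ + 1) * S ^ 2) ^ d :=
    calc rk ≤ rk * δ := Nat.le_mul_of_pos_right rk hδ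
      _ ≤ δH * M ^ d := key
      _ ≤ δH * ((4 * C₀ + 1) * S ^ 2) ^ d :=
        Nat.mul_le_mul_left _ (Nat.pow_le_pow_left hMS d)
  rw [mul_pow, ← mul_assoc] at h1
  rw [pow_mul]
  exact_mod_cast h1

open Classical in
/-- **The degree bound from the theorem of the cube alone**: for an abelian variety `X` of
dimension `g > 0` all of whose non-zero endomorphisms are isogenies and every finite family `e` of
endomorphisms, `deg (∑ nᵢ eᵢ) ≤ C_e (∑ |nᵢ|)^{2g}` — `kerRank_sum_le_of_cubicalStructure` with the
cubical structure (`cubicalStructure_linEquiv_of_theoremOfCube`, Görtz–Wedhorn II, Prop. 27.167)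
and an ample divisor (`exists_isAmple_symmetric_of_cube`, Prop. 27.174) both supplied by the
Theorem of the Cube (Thm. 24.73, the named fact `theoremOfCube_linEquiv`). This is the form of
Mumford §19 Thm. 2 consumed by the proof of Thm. 3.
[cite: MumfordAV1970, §19 Thm. 2 (p. 174) and §6 Cor. 2 (p. 58)] -/
theorem kerRank_sum_le_of_theoremOfCube (hcube : theoremOfCube_linEquiv.{u}) (X : AbelianVariety K)
    (hiso : ∀ φ : X ⟶ X, φ ≠ 0 → IsIsogeny φ) (hX : 0 < X.dim) (r : ℕ) (e : Fin r → (X ⟶ X)) :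
    ∃ C : ℤ, ∀ n : Fin r → ℤ,
      (if IsIsogeny (∑ i, n i • e i) then (Hom.kerRank (∑ i, n i • e i) : ℤ) else 0) ≤
        C * (∑ i, |n i|) ^ (2 * X.dim) := by
  obtain ⟨D, hD, -⟩ := X.exists_isAmple_symmetric_of_cube hcube
  exact kerRank_sum_le_of_cubicalStructure X (X.cubicalStructure_linEquiv_of_theoremOfCube hcube)
    ⟨D, hD⟩ hiso hX r e

end AbelianVariety

end Literature.AlgebraicGeometry.Motives
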